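import Mathlib
import Summits.Ventures.PercRepro2.Defs
import Summits.Ventures.PercRepro2.Independence
import Summits.Ventures.PercRepro2.Harris
import Summits.Ventures.PercRepro2.Graph
import Summits.Ventures.PercRepro2.Exploration
import Summits.Ventures.PercRepro2.Events
import Summits.Ventures.PercRepro2.FourFunctions
import Summits.Ventures.PercRepro2.Induced
import Summits.Ventures.PercRepro2.Frontier
import Summits.Ventures.PercRepro2.ObsIndependence
import Summits.Ventures.PercRepro2.BHK
import Summits.Ventures.PercRepro2.BHKEvents
import Summits.Ventures.PercRepro2.OrderPreservation
import Summits.Ventures.PercRepro2.BHKAvoid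
import Summits.Ventures.PercRepro2.SameClusterAvoid
import Summits.Ventures.PercRepro2.CaseOneRegime
import Summits.Ventures.PercRepro2.CaseOnePos
import Summits.Ventures.PercRepro2.CaseOneJ11
import Summits.Ventures.PercRepro2.CaseOneRV
import Summits.Ventures.PercRepro2.CaseOnePendant
import Summits.Ventures.PercRepro2.CaseOnePendantAny
import Summits.Ventures.PercRepro2.CaseOnePendantNec
import Summits.Ventures.PercRepro2.HullDefs
import Summits.Ventures.PercRepro2.OneEdge
import Summits.Ventures.PercRepro2.StarPattern
import Summits.Ventures.PercRepro2.HCov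
import Summits.Ventures.PercRepro2.HCovSwap
import Summits.Ventures.PercRepro2.OddsLemma
import Summits.Ventures.PercRepro2.RV
import Summits.Ventures.PercRepro2.RVBridge
import Summits.Ventures.PercRepro2.CaseOneDWorld
import Summits.Ventures.PercRepro2.CaseOneDWorldPin
import Summits.Ventures.PercRepro2.CaseOneDWorldEdge
import Summits.Ventures.PercRepro2.CaseOneDWorldLeaf
import Summits.Ventures.PercRepro2.CaseOneDWorldOdds
import Summits.Ventures.PercRepro2.CaseOneRootsOnly

/-!
# `(ii)` when every edge at `a₃` goes to a root or to ONE further vertex `v ∈ {o, b}` (blind cell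
PercRepro2, p1 g14; S5 §2.1 (K9) (e), the unconditional classes with multiplicities)

Induction on the non-null ROOT edges at `a₃` (each pinned closed at no cost in the D-world,
`zSplitIID_of_a1_edge` / `zSplitIID_of_a2_edge`) reduces to the state where `a₃` is a leaf at `v` in the
support (`IsLeafSupp`), where the pendant step `zSplitIID_of_leaf_supp` applies with the base cases
`iiExprD_nonneg_of_a3_eq_o` / `iiExprD_nonneg_of_a3_eq_b` at the mixed pair (`odds_mix`):
**`zSplitII_of_rootsAndO`**, **`zSplitII_of_rootsAndB`** — `(ii)` for `a₃` adjacent to the roots (any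
multiplicities) and to `o`, resp. to `b`, through one edge of any weight. The general induction
`zSplitIID_of_rootsAnd` takes any base valid when the root edges are null. Own code; standard axioms.
-/

namespace Summit.Ventures.PercRepro2

namespace CaseOne

section Induction
variable {V : Type*} {E : Type*} [Fintype E] [DecidableEq E] [Fintype V] [DecidableEq V]
  {R : Type*} [Field R] [LinearOrder R] [IsStrictOrderedRing R]
variable {ends : E → Sym2 V} {a₁ a₂ a₃ : V} {e₀ : E}

/-- The non-null edges at `a₃` other than `e₀`. -/
def liveRoot (p : E → R) (ends : E → Sym2 V) (a₃ : V) (e₀ : E) : Finset E :=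
  Finset.univ.filter fun e => a₃ ∈ ends e ∧ e ≠ e₀ ∧ p e ≠ 0

omit [Fintype V] [IsStrictOrderedRing R] in
/-- Pinning a live root edge removes it from the live set. -/
lemma liveRoot_update (p : E → R) (ends : E → Sym2 V) (a₃ : V) (e₀ e : E) :
    liveRoot (Function.update p e 0) ends a₃ e₀ = (liveRoot p ends a₃ e₀).erase e := by
  ext e'
  simp only [liveRoot, Finset.mem_filter, Finset.mem_univ, true_and, Finset.mem_erase, ne_eq]
  by_cases h : e' = e
  · subst h; simp
  · rw [Function.update_of_ne h]; tauto

/-- **Induction over the root edges at `a₃`**: if every edge at `a₃` other than `e₀` is a root edge and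
`ZSplitIID` holds for every admissible weight vector with all those root edges null, then it holds. -/
theorem zSplitIID_of_rootsAnd (p : E → R) (hp : IsProbVec p)
    (hroot : ∀ e, a₃ ∈ ends e → e ≠ e₀ → ends e = s(a₁, a₃) ∨ ends e = s(a₂, a₃)) {o b : V}
    (base : ∀ p' : E → R, IsProbVec p' → (∀ e, a₃ ∈ ends e → e ≠ e₀ → p' e = 0) →
      ZSplitIID p' ends o a₁ a₂ a₃ b) :
    ZSplitIID p ends o a₁ a₂ a₃ b := by
  generalize hn : (liveRoot p ends a₃ e₀).card = n
  induction n using Nat.strong_induction_on generalizing p with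
  | _ n ih =>
    by_cases h0 : liveRoot p ends a₃ e₀ = ∅
    · refine base p hp fun e he hne => ?_
      by_contra hc
      have : e ∈ liveRoot p ends a₃ e₀ := by simp [liveRoot, he, hne, hc]
      rw [h0] at this
      exact absurd this (Finset.notMem_empty e)
    · obtain ⟨e, he⟩ := Finset.nonempty_iff_ne_empty.mpr h0
      have he' : a₃ ∈ ends e ∧ e ≠ e₀ := by
        have := he
        simp only [liveRoot, Finset.mem_filter, Finset.mem_univ, true_and] at this
        exact ⟨this.1, this.2.1⟩
      have hlt : ((liveRoot p ends a₃ e₀).erase e).card < n := by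
        rw [← hn]; exact Finset.card_erase_lt_of_mem he
      have hp0 : IsProbVec (Function.update p e 0) := hp.update e le_rfl zero_le_one
      have hrec := ih _ hlt (Function.update p e 0) hp0 (by rw [liveRoot_update])
      rcases hroot e he'.1 he'.2 with h | h
      · exact zSplitIID_of_a1_edge p hp h o b hrec
      · exact zSplitIID_of_a2_edge p hp h o b hrec

end Induction

section Marked
variable {V : Type*} {E : Type*} [Fintype E] [DecidableEq E] [Fintype V] [DecidableEq V]
  {R : Type*} [Field R] [LinearOrder R] [IsStrictOrderedRing R]
variable {ends : E → Sym2 V} {a₁ a₂ a₃ : V} {e₀ : E}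

/-- **`(ii)` for `a₃` adjacent to the roots (any multiplicities) and to `o`** through `e₀`. -/
theorem zSplitII_of_rootsAndO (p : E → R) (hp : IsProbVec p) {o : V} (he₀ : ends e₀ = s(o, a₃))
    (hroot : ∀ e, a₃ ∈ ends e → e ≠ e₀ → ends e = s(a₁, a₃) ∨ ends e = s(a₂, a₃)) (ho : o ≠ a₃)
    (h1 : a₁ ≠ a₃) (h2 : a₂ ≠ a₃) {b : V} (hb : b ≠ a₃) : ZSplitII p ends o a₁ a₂ a₃ b := by
  refine zSplitII_of_dworld p hp ends o a₁ a₂ a₃ b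
    (zSplitIID_of_rootsAnd p hp hroot fun p' hp' hnull => ?_)
  have hl : IsLeafSupp p' ends o a₃ e₀ := ⟨he₀, fun e he hne => hnull e he hne, ho⟩
  exact zSplitIID_of_leaf_supp hp' hl ho h1 h2 hb
    (iiExprD_nonneg_of_a3_eq_o _ (hp'.update e₀ le_rfl zero_le_one) ends o a₁ a₂ b _ _
      (prob_nonneg hp' _))

/-- **`(ii)` for `a₃` adjacent to the roots (any multiplicities) and to `b`** through `e₀`. -/
theorem zSplitII_of_rootsAndB (p : E → R) (hp : IsProbVec p) {b : V} (he₀ : ends e₀ = s(b, a₃))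
    (hroot : ∀ e, a₃ ∈ ends e → e ≠ e₀ → ends e = s(a₁, a₃) ∨ ends e = s(a₂, a₃)) (hb : b ≠ a₃)
    (h1 : a₁ ≠ a₃) (h2 : a₂ ≠ a₃) {o : V} (ho : o ≠ a₃) : ZSplitII p ends o a₁ a₂ a₃ b := by
  refine zSplitII_of_dworld p hp ends o a₁ a₂ a₃ b
    (zSplitIID_of_rootsAnd p hp hroot fun p' hp' hnull => ?_)
  have hl : IsLeafSupp p' ends b a₃ e₀ := ⟨he₀, fun e he hne => hnull e he hne, hb⟩
  have hp00 : IsProbVec (Function.update p' e₀ 0) := hp'.update e₀ le_rfl zero_le_one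
  refine zSplitIID_of_leaf_supp hp' hl ho h1 h2 hb ?_
  refine iiExprD_nonneg_of_a3_eq_b _ hp00 ends o a₁ a₂ b _ _ ?_
  rw [Dpd_leaf_supp hl h1 h2, Dpdo_leaf_supp hl ho h1 h2]
  exact odds_mix (Function.update p' e₀ 0) hp00 ends o a₁ a₂ b (p' e₀) (hp'.nonneg e₀) (hp'.le_one e₀)

/-- **`(RV)` for `a₃` adjacent to the roots and to `o`** (when the required-vertex world has mass). -/
theorem rv_of_rootsAndO (p : E → R) (hp : IsProbVec p) {o : V} (he₀ : ends e₀ = s(o, a₃))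
    (hroot : ∀ e, a₃ ∈ ends e → e ≠ e₀ → ends e = s(a₁, a₃) ∨ ends e = s(a₂, a₃)) (ho : o ≠ a₃)
    (h1 : a₁ ≠ a₃) (h2 : a₂ ≠ a₃) {b : V} (hb : b ≠ a₃) (hT : 0 < prob p (Tp ends a₁ a₂ a₃)) :
    RV p ends o a₁ a₂ a₃ b :=
  (rv_iff_ii p ends o a₁ a₂ a₃ b hT).2 (zSplitII_of_rootsAndO p hp he₀ hroot ho h1 h2 hb)

/-- **`(RV)` for `a₃` adjacent to the roots and to `b`** (when the required-vertex world has mass). -/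
theorem rv_of_rootsAndB (p : E → R) (hp : IsProbVec p) {b : V} (he₀ : ends e₀ = s(b, a₃))
    (hroot : ∀ e, a₃ ∈ ends e → e ≠ e₀ → ends e = s(a₁, a₃) ∨ ends e = s(a₂, a₃)) (hb : b ≠ a₃)
    (h1 : a₁ ≠ a₃) (h2 : a₂ ≠ a₃) {o : V} (ho : o ≠ a₃) (hT : 0 < prob p (Tp ends a₁ a₂ a₃)) :
    RV p ends o a₁ a₂ a₃ b :=
  (rv_iff_ii p ends o a₁ a₂ a₃ b hT).2 (zSplitII_of_rootsAndB p hp he₀ hroot hb h1 h2 ho)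

end Marked

end CaseOne

end Summit.Ventures.PercRepro2
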